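import Mathlib
import HarnessLib
import Summits.HubbardSuperconductivity.HubbardSuperconductivity.Theorems.KLProgrammeKLRegimeSectorMultiplierSingleDiffs
import Summits.HubbardSuperconductivity.HubbardSuperconductivity.Theorems.KLProgrammeSectorisedLegKernelsDefs

/-!
# Route `KLProgramme` — engine support (stmt-HubbardSuperconductivity-20437, row (b) producer `hexI`, geometry datum `hisoW`): the ISOTROPIC single-multiplier
# symbol `F_σ = klIsoFamily … m σ` on an admissible frame — symbol identity, vanishing, cell, and its THIRD differences in time and along any integer spatial step
# at the ISOTROPIC rate `Λ_m`, plus the support count (iso twin of p3 g10's `…SymbolFrameInstanceSingle` + `…SectorMultiplierSingleDiffs`; brick (F1) of the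
# `hisoW` supplier plan, cell gate-hubbard-kl, seat p3 g24)

KEY FACT.  `klIsoMultiplier` and `bgmMultiplier` share the radial factor `gnScaleCutoff 4 e₀ (−m) (√(k₀² + e_K²)) = bgmCutoffSq e₀ (16^m (k₀² + e_K²))` and differ ONLY in the
angular index: `sectorWeightCirc (2m) σ` (iso) vs `sectorWeightCirc m ω` (thin).  The single angular-factor layer `…SymbolAngularFactorSingle` is generic in the angular
index (`n : ℕ`, `ω : ℤ`), and the cell lemma `frameBand_cell` takes the angular index and the shell bound separately, so the thin single third-difference pack ports to
the iso family with radial index `m`, angular index `2m`: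
* `klIso_eq_symbol`, `isoSymbol₁_vanish`, `isoSymbol₁_cell`, `inner_of_square_shell_iso` (sup `≤ 1` is p4 g7's `norm_klIsoFamily_le_one`);
* **`norm_fwdDiff_three_time_klIso_le`** (`‖Δ³_{(1,0)} G̃‖ ≤ (8g₃+12g₂)(2π/β)³/Λ_m³`), **`norm_fwdDiff_three_space_klIso_le`** (isotropic order-three bound along an integer step
  `u`, `6π|u_j| ≤ zL`, angular size `D = (1+6/w_{2m})‖w‖`), **`card_support_klIso_le`** (time window × iso cell box, `ρ = (Λ_m + s_max Dt_min (3w_{2m}/4))/(Dt_min − 2A)`).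
These are the inputs of the isotropic weighted master lemma `sum_wt_norm_charSum_le_of_third_differences_axes` (brick (F2), next file).
Everything is proved; no definitions, no named facts; nothing about the model's sizes is asserted. [folklore] (BGM 2006 §2.5 Lemma 2.2 (2.52)–(2.56).)
-/

noncomputable section

namespace Summit.HubbardSuperconductivity.HubbardSuperconductivity.Theorems.TorusFourierL2

set_option linter.dupNamespace false -- summit = problem name (single-conjunct summit), D-0017

open Set Finset Literature.MathematicalPhysics.QuantumLattice Literature.MathematicalPhysics.QuantumLattice.BandSectorCounting
open Literature.MathematicalPhysics.QuantumLattice.FermiRG Literature.Probability.LatticeModels Literature.Analysis.SpecialFunctions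
open Summit.HubbardSuperconductivity.HubbardSuperconductivity.Theorems.DispersionFlow
open Summit.HubbardSuperconductivity.HubbardSuperconductivity.Theorems.KLRegimeSplit
open Summit.HubbardSuperconductivity.HubbardSuperconductivity.Theorems.KLProgrammeLegKernels
open Summit.HubbardSuperconductivity.HubbardSuperconductivity.Theorems.PerturbedFermiCurve
open scoped Real

section IsoSingle

variable {L M : ℕ} [NeZero L] [NeZero M] {a b : ℝ} (B : BandBounds a b) {K : TrigPolyC4v} {A A₃ : ℝ}
  (hA : ∀ p : Momentum, ∀ j ≤ 2, ‖iteratedFDeriv ℝ j (frameShift K) p‖ ≤ A) (hADt : 2 * A < B.Dtmin)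
  (hA3 : ∀ p : Momentum, ‖iteratedFDeriv ℝ 3 (frameShift K) p‖ ≤ A₃)
  {μ e₀ z β : ℝ} (he : 0 < e₀) (hz : 0 < z) (hz1 : z ≤ 1) (hgap : e₀ + A + z ^ 2 < -μ) (h3 : e₀ + A - μ ≤ 3)
  (hlo : a ≤ μ - A - e₀) (hhi : μ + A + e₀ ≤ b) (hβ : 0 < β) (hρA : 4 * A < 2 * B.rhomin)
  {m : ℕ} (σ : Fin (sectorCount (2 * m)))
  {d : ℝ} (hd : 0 ≤ d) (hd1 : ∀ u, |deriv (bgmCutoffSq e₀) u| ≤ d) (hd2 : ∀ u, |iteratedDeriv 2 (bgmCutoffSq e₀) u| ≤ d)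
  (hd3 : ∀ u, |iteratedDeriv 3 (bgmCutoffSq e₀) u| ≤ d)
  {Z : (Fin 2 → ℝ) → ℝ}
  (hZ : ∀ p, Z p = gnCutoff ((π + z) ^ 2 / π ^ 2) ((π + z) ^ 2) (p 0 ^ 2) * gnCutoff ((π + z) ^ 2 / π ^ 2) ((π + z) ^ 2) (p 1 ^ 2) *
    (radialCutoffC (1 / 2) (momToComplex p) * sectorWeightCirc (2 * m) ((σ : ℕ) : ℤ) (polarAngle p)))
  {Φ : ℝ × (Fin 2 → ℝ) → ℂ}
  (hΦ : ∀ k₀ p, Φ (k₀, p) = ((bgmCutoffSq e₀ ((16 : ℝ) ^ m * (k₀ ^ 2 + frameLevel μ K (WithLp.toLp 2 p) ^ 2)) * Z p : ℝ) : ℂ))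
  {Gs : TorusSite 1 (2 * M) × TorusSite 2 L → ℂ}
  (hGs : ∀ q, Gs q = klIsoFamily L M β μ K e₀ m σ (⟨(q.1 0).val, ZMod.val_lt (q.1 0)⟩, q.2))

include hA h3 he hz hΦ hZ in
/-- **The single multiplier IS the sample of the continuum symbol**: for every product-torus label `q`,
`klIsoFamily … m σ (k(q)) = Φ(π(1−2M)/β + (2π/β)·val q₁, (2π/L)·q̃₂)`. [cite: BenfattoGiulianiMastropietro2006, §2.5 (2.45)–(2.48)] -/
theorem klIso_eq_symbol (q : TorusSite 1 (2 * M) × TorusSite 2 L) :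
    klIsoFamily L M β μ K e₀ m σ (⟨(q.1 0).val, ZMod.val_lt (q.1 0)⟩, q.2) =
      Φ (π * (1 - 2 * M) / β + 2 * π / β * (((q.1 0).val : ℕ) : ℝ), fun j => 2 * π / L * (((q.2 j).valMinAbs : ℤ) : ℝ)) := by
  have hsp := sampledPoint_eq (L := L) (M := M) β q
  rw [← hsp, hΦ]
  set k₀ : ℝ := matsubaraFreq β M (⟨(q.1 0).val, ZMod.val_lt (q.1 0)⟩ : MatsubaraIdx M) with hk₀
  set c : Fin 2 → ℝ := torusCentredMomentum L q.2 with hc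
  have he_eq : nambuXiCT L μ K q.2 = frameLevel μ K (WithLp.toLp 2 c) := nambuXiCT_eq_frameLevel L μ K q.2
  have hang : momentumAngle L q.2 = polarAngle c := rfl
  set u : ℝ := k₀ ^ 2 + frameLevel μ K (WithLp.toLp 2 c) ^ 2 with hu
  have hF : klIsoFamily L M β μ K e₀ m σ (⟨(q.1 0).val, ZMod.val_lt (q.1 0)⟩, q.2) =
      ((gnScaleCutoff 4 e₀ (-(m : ℤ)) (Real.sqrt u) * sectorWeightCirc (2 * m) ((σ : ℕ) : ℤ) (polarAngle c) : ℝ) : ℂ) := by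
    rw [klIsoFamily, klIsoMultiplier, he_eq, hang]
  rw [hF]
  congr 1
  have hcπ : ∀ j, |c j| ≤ π := abs_torusCentredMomentum_le_pi L q.2
  have hsq : ∀ j, gnCutoff ((π + z) ^ 2 / π ^ 2) ((π + z) ^ 2) (c j ^ 2) = 1 := fun j =>
    sqCutoff_eq_one hz (by rw [← sq_abs]; exact pow_le_pow_left₀ (abs_nonneg _) (hcπ j) 2)
  rw [hZ c, hsq 0, hsq 1, one_mul, one_mul]
  by_cases hR : (1 : ℝ) / 2 ≤ ‖momToComplex c‖
  · rw [radialCutoffC_eq_one (by norm_num) hR, one_mul, gnScaleCutoff_sqrt_eq_bgmCutoffSq]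
  · have hnot : ¬ (1 : ℝ) ≤ ‖momToComplex c‖ := fun h1 => hR (by linarith)
    have hbig : e₀ < |frameLevel μ K (WithLp.toLp 2 c)| := by
      by_contra hle
      exact hnot (one_le_norm_of_frameBand_le hA h3 (not_lt.1 hle))
    have h1 : gnScaleCutoff 4 e₀ (-(m : ℤ)) (Real.sqrt u) = 0 := gnScaleCutoff_eq_zero_of_band_gt he m hbig
    have h1' : bgmCutoffSq e₀ ((16 : ℝ) ^ m * u) = 0 := by rw [← gnScaleCutoff_sqrt_eq_bgmCutoffSq]; exact h1
    rw [h1, h1']; ring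

include hA hz hz1 hgap he hΦ hZ in
/-- **Vanishing of the continuum symbol** (one bundle, so as not to shadow the pair file's statement shapes): (i) ZONE — `Φ(k₀, p) = 0` as soon as
some `|p_j| ≥ π − z`; (ii) OFF-SHELL — `Φ(k₀, p) = 0` as soon as `Λ_n² < k₀² + e_K(p)²`. [folklore] -/
theorem isoSymbol₁_vanish :
    (∀ (k₀ : ℝ) (p : Fin 2 → ℝ), (∃ j, π - z ≤ |p j|) → Φ (k₀, p) = 0) ∧
      ∀ (k₀ : ℝ) (p : Fin 2 → ℝ), klScale e₀ m ^ 2 < k₀ ^ 2 + frameLevel μ K (WithLp.toLp 2 p) ^ 2 → Φ (k₀, p) = 0 := by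
  obtain ⟨d, -, hd1, hd2⟩ := exists_abs_derivs_bgmCutoffSq_le he
  have hoff : ∀ (k₀ : ℝ) (p : Fin 2 → ℝ), klScale e₀ m ^ 2 < k₀ ^ 2 + frameLevel μ K (WithLp.toLp 2 p) ^ 2 → Φ (k₀, p) = 0 := by
    intro k₀ p hu
    rw [hΦ, (scaleProfile_bounds he m hd1 hd2).2.2.2.2 _ hu]; simp
  refine ⟨fun k₀ p hp => ?_, hoff⟩
  obtain ⟨j, hj⟩ := hp
  rcases le_or_gt (π + z) |p j| with hfar | hnear
  · rw [hΦ, (angularFactor₁_smooth_abs_zone hZ hz).2.2 p ⟨j, hfar⟩]; simp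
  · have hband : e₀ < |frameLevel μ K (WithLp.toLp 2 p)| := frameBand_zone hA hz1 hgap hj hnear.le
    refine hoff k₀ p ?_
    have h1 := klScale_le_e0 he.le m
    have h2 : 0 < klScale e₀ m := by rw [klScale]; positivity
    have h3' : e₀ ^ 2 < frameLevel μ K (WithLp.toLp 2 p) ^ 2 := by
      have := sq_lt_sq' (by linarith [abs_nonneg (frameLevel μ K (WithLp.toLp 2 p))]) hband
      rwa [sq_abs] at this
    nlinarith [pow_le_pow_left₀ h2.le h1 2, sq_nonneg k₀]



include B hA hADt hz hz1 hgap he hlo hhi hZ in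
/-- **Cell**: a point of the square-with-margin in the shell `|e_K| ≤ Λ_m` with `Z ≠ 0` is within `(Λ_m + s_max Dt_min (3w_{2m}/4))/(Dt_min − 2A)`
of `klFermiPoint μ K θ_{2m,σ}` (sup norm) — `frameBand_cell` at angular index `2m`. [cite: BenfattoGiulianiMastropietro2006, §2.7 (2.69)] -/
theorem isoSymbol₁_cell (p : Fin 2 → ℝ) (hsq : ∀ i, |p i| ≤ π + z) (hshell : |frameLevel μ K (WithLp.toLp 2 p)| ≤ klScale e₀ m)
    (hZp : Z p ≠ 0) :
    ‖p - klFermiPoint μ K (sectorCenter (2 * m) (σ : ℕ))‖ ≤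
      (klScale e₀ m + B.smax * B.Dtmin * (3 * sectorWidth (2 * m) / 4)) / (B.Dtmin - 2 * A) := by
  have hΛ := klScale_le_e0 he.le m
  have hζ := angularFactor₁_support hZ hZp
  exact frameBand_cell B hA hADt hz.le hz1 (by linarith) (by linarith) (by linarith) (2 * m) (σ : ℕ) hsq hshell hζ

include hA he hz hz1 hgap h3 hZ in
/-- Points of the enlarged square `|p_i| ≤ π + z` in the shell `|e_K| ≤ Λ_m` are in the OPEN square and in the Fermi region. [folklore] -/
theorem inner_of_square_shell_iso (p : Fin 2 → ℝ) (hsq : ∀ i, |p i| ≤ π + z) (hshell : |frameLevel μ K (WithLp.toLp 2 p)| ≤ klScale e₀ m) :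
    (∀ i, |p i| < π) ∧ 1 ≤ ‖momToComplex p‖ := by
  have hΛe : klScale e₀ m ≤ e₀ := klScale_le_e0 he.le m
  have _ := hZ
  have _ := hz
  refine ⟨fun i => ?_, one_le_norm_of_frameBand_le hA h3 (hshell.trans hΛe)⟩
  by_contra hge
  push Not at hge
  have h1 : π - z ≤ |p i| := by linarith
  have := frameBand_zone hA hz1 hgap h1 (hsq i)
  exact absurd (hshell.trans hΛe) (not_le.2 this)

include hA he hz h3 hβ hd1 hd2 hd3 hZ hΦ hGs in
/-- **Time direction, order three**: `‖Δ³_{(1,0)} G̃(q)‖ ≤ (8g₃ + 12g₂)(2π/β)³/Λ_n³` for every `q`, provided `Λ_nβ < π(2M − 5)`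
(`g₂ = d e₀⁴`, `g₃ = d e₀⁶`). [cite: BenfattoGiulianiMastropietro2006, §2.5 Lemma 2.2 (2.52), (2.56)] -/
theorem norm_fwdDiff_three_time_klIso_le (hM : klScale e₀ m * β < π * (2 * M - 5)) (q : TorusSite 1 (2 * M) × TorusSite 2 L) :
    ‖((fwdDiff ((fun _ : Fin 1 => (1 : ZMod (2 * M))), (0 : TorusSite 2 L)))^[3] Gs) q‖ ≤
      (8 * (d * e₀ ^ 6) + 12 * (d * e₀ ^ 4)) * |2 * π / β| ^ 3 * 1 / klScale e₀ m ^ 3 := by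
  obtain ⟨hGc, -, hG1, hG2, hG3, hGv⟩ := scaleProfile_bounds₃ he m hd1 hd2 hd3
  have hΛ : 0 < klScale e₀ m := by rw [klScale]; positivity
  have hd0 : 0 ≤ d := le_trans (abs_nonneg _) (hd1 0)
  exact norm_fwdDiff_three_time_sampledSymbol_le hGc hΛ (by positivity) (by positivity) (by positivity) hG1 hG2 hG3 hGv
    (fun p : Fin 2 → ℝ => frameLevel μ K (WithLp.toLp 2 p)) Z ((angularFactor₁_smooth_abs_zone hZ hz).2.1) Φ (fun k₀ p => hΦ k₀ p)
    (π * (1 - 2 * M) / β) (2 * π / β) (2 * π / L) (fun m hm => symbol_window₃ hβ hM m hm) Gs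
    (fun q => (hGs q).trans (klIso_eq_symbol hA he hz h3 σ hZ hΦ q)) q

include hA hA3 he hz hz1 hgap h3 hd hd1 hd2 hd3 hZ hΦ hGs in
/-- **Space direction, order three, isotropic form** along an integer step `u` with `6π|u_j| ≤ zL` (`w = 2πu/L`): with the angular constant `B_a` of
`exists_norm_iteratedDeriv_sectorWeightCirc_polarAngle_line_le 3`, `τ = (4+2A)‖w‖`, `K₂ = 4+4A`, `K₃ = 4+8A₃`, `D = (1+6/w_n)‖w₁+iw₂‖`,
`g₁ = de₀²`, `g₂ = de₀⁴`, `g₃ = de₀⁶`: for EVERY `q`,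
`‖Δ³_{(0,ū)} G̃(q)‖ ≤ [(8g₃+12g₂)τ³/Λ³ + (12g₂+6g₁)τK₂‖w‖²/Λ² + 2g₁K₃‖w‖³/Λ]·1 + 3[(4g₂+2g₁)τ²/Λ² + 2g₁K₂‖w‖²/Λ]·6B_aD + 3(2g₁τ/Λ)·6B_aD² + 6B_aD³`.
[cite: BenfattoGiulianiMastropietro2006, §2.5 Lemma 2.2 (2.53)–(2.55)] -/
theorem norm_fwdDiff_three_space_klIso_le {Ba : ℝ} (hB0 : 0 ≤ Ba)
    (hB : ∀ (i : ℕ), i ≤ 3 → ∀ (n : ℕ) (ω : ℤ) (θ₀ : ℝ) (q w : Fin 2 → ℝ) (t : ℝ) {r₀ : ℝ}, 0 < r₀ →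
      r₀ ≤ ‖momToComplex (q + t • w)‖ → |sectorRelAngle θ₀ (q + t • w)| < π →
      ‖iteratedDeriv i (fun t : ℝ => sectorWeightCirc n ω (polarAngle (q + t • w))) t‖ ≤
        (3 : ℕ).factorial * Ba * ((1 + (sectorWidth n)⁻¹ * (3 : ℕ).factorial) * ‖momToComplex w‖ / r₀) ^ i)
    (u : Fin 2 → ℤ) (hu : ∀ j, 3 * |2 * π / L| * |(u j : ℝ)| ≤ z) (q : TorusSite 1 (2 * M) × TorusSite 2 L) :
    ‖((fwdDiff ((0 : TorusSite 1 (2 * M)), (fun j => ((u j : ℤ) : ZMod L))))^[3] Gs) q‖ ≤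
      ((8 * (d * e₀ ^ 6) + 12 * (d * e₀ ^ 4)) * ((4 + 2 * A) * ‖(fun j => 2 * π / L * (u j : ℝ))‖) ^ 3 / klScale e₀ m ^ 3 +
          (12 * (d * e₀ ^ 4) + 6 * (d * e₀ ^ 2)) *
            (((4 + 2 * A) * ‖(fun j => 2 * π / L * (u j : ℝ))‖) * ((4 + 4 * A) * ‖(fun j => 2 * π / L * (u j : ℝ))‖ ^ 2)) /
              klScale e₀ m ^ 2 +
          2 * (d * e₀ ^ 2) * ((4 + 8 * A₃) * ‖(fun j => 2 * π / L * (u j : ℝ))‖ ^ 3) / klScale e₀ m) * 1 +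
        3 * (((4 * (d * e₀ ^ 4) + 2 * (d * e₀ ^ 2)) * ((4 + 2 * A) * ‖(fun j => 2 * π / L * (u j : ℝ))‖) ^ 2 / klScale e₀ m ^ 2 +
              2 * (d * e₀ ^ 2) * ((4 + 4 * A) * ‖(fun j => 2 * π / L * (u j : ℝ))‖ ^ 2) / klScale e₀ m) *
            (6 * Ba * ((1 + 6 * (sectorWidth (2 * m))⁻¹) * ‖momToComplex (fun j => 2 * π / L * (u j : ℝ))‖))) +
        3 * (2 * (d * e₀ ^ 2) * ((4 + 2 * A) * ‖(fun j => 2 * π / L * (u j : ℝ))‖) / klScale e₀ m *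
            (6 * Ba * ((1 + 6 * (sectorWidth (2 * m))⁻¹) * ‖momToComplex (fun j => 2 * π / L * (u j : ℝ))‖) ^ 2)) +
        1 * (6 * Ba * ((1 + 6 * (sectorWidth (2 * m))⁻¹) * ‖momToComplex (fun j => 2 * π / L * (u j : ℝ))‖) ^ 3) := by
  obtain ⟨hGc, hG0, hG1, hG2, hG3, hGv⟩ := scaleProfile_bounds₃ he m hd1 hd2 hd3
  have hΛ : 0 < klScale e₀ m := by rw [klScale]; positivity
  have hL : (0 : ℝ) < L := Nat.cast_pos.2 (Nat.pos_of_ne_zero (NeZero.ne L))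
  set w : Fin 2 → ℝ := fun j => 2 * π / L * (u j : ℝ) with hw
  set eK : (Fin 2 → ℝ) → ℝ := fun p => frameLevel μ K (WithLp.toLp 2 p) with heK
  have hD : 0 ≤ (1 + 6 * (sectorWidth (2 * m))⁻¹) * ‖momToComplex w‖ := by have := sectorWidth_pos (2 * m); positivity
  obtain ⟨hZc, hZabs, -⟩ := angularFactor₁_smooth_abs_zone hZ hz
  have hZ1 : ∀ (p₀ : Fin 2 → ℝ) (s : ℝ), (∀ i, |(p₀ + s • w) i| ≤ π + z) → |eK (p₀ + s • w)| ≤ klScale e₀ m →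
      |deriv (fun s : ℝ => Z (p₀ + s • w)) s| ≤ 6 * Ba * ((1 + 6 * (sectorWidth (2 * m))⁻¹) * ‖momToComplex w‖) := by
    intro p₀ s hsq hshell
    obtain ⟨hin, hfermi⟩ := inner_of_square_shell_iso hA he hz hz1 hgap h3 σ hZ _ hsq hshell
    exact (abs_derivs_angularFactor₁_line_le hz hZ hB p₀ w hin hfermi).1
  have hZ2 : ∀ (p₀ : Fin 2 → ℝ) (s : ℝ), (∀ i, |(p₀ + s • w) i| ≤ π + z) → |eK (p₀ + s • w)| ≤ klScale e₀ m →
      |iteratedDeriv 2 (fun s : ℝ => Z (p₀ + s • w)) s| ≤ 6 * Ba * ((1 + 6 * (sectorWidth (2 * m))⁻¹) * ‖momToComplex w‖) ^ 2 := by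
    intro p₀ s hsq hshell
    obtain ⟨hin, hfermi⟩ := inner_of_square_shell_iso hA he hz hz1 hgap h3 σ hZ _ hsq hshell
    exact (abs_derivs_angularFactor₁_line_le hz hZ hB p₀ w hin hfermi).2.1
  have hZ3 : ∀ (p₀ : Fin 2 → ℝ) (s : ℝ), (∀ i, |(p₀ + s • w) i| ≤ π + z) → |eK (p₀ + s • w)| ≤ klScale e₀ m →
      |iteratedDeriv 3 (fun s : ℝ => Z (p₀ + s • w)) s| ≤ 6 * Ba * ((1 + 6 * (sectorWidth (2 * m))⁻¹) * ‖momToComplex w‖) ^ 3 := by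
    intro p₀ s hsq hshell
    obtain ⟨hin, hfermi⟩ := inner_of_square_shell_iso hA he hz hz1 hgap h3 σ hZ _ hsq hshell
    exact (abs_derivs_angularFactor₁_line_le hz hZ hB p₀ w hin hfermi).2.2
  have hxL : |2 * π / (L : ℝ)| * L = 2 * π := by rw [abs_of_pos (by positivity)]; field_simp
  have hτ : ∀ p : Fin 2 → ℝ, |fderiv ℝ eK p w| ≤ (4 + 2 * A) * ‖w‖ := fun p => abs_fderiv_frameBand_apply_le hA μ p w
  exact norm_fwdDiff_three_space_sampledSymbol_le' hGc hΛ zero_le_one (by positivity) (by positivity) (by positivity) hG0 hG1 hG2 hG3 hGv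
    (contDiff_three_frameBand μ K) (norm_iteratedFDeriv_two_frameBand_le hA μ) (norm_iteratedFDeriv_three_frameBand_le hA3 μ) w hτ
    (hZc 3) zero_le_one (by positivity) (by positivity) (by positivity) hZabs hZ1 hZ2 hZ3
    Φ (fun k₀ p => hΦ k₀ p) (π * (1 - 2 * M) / β) (2 * π / β) (2 * π / L) u rfl hu
    (fun k₀ p hp => (isoSymbol₁_vanish hA he hz hz1 hgap σ hZ hΦ).1 k₀ p hp) hxL Gs
    (fun q => (hGs q).trans (klIso_eq_symbol hA he hz h3 σ hZ hΦ q)) q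

include B hA hADt he hz hz1 hgap h3 hlo hhi hβ hρA hd1 hd2 hZ hΦ hGs in
/-- **Support count of the single-multiplier symbol**: time window × rotated box,
`#{G̃ ≠ 0} ≤ (Λ_nβ/π + 1)·(√2 L (Λ_n + (4+4A)ρ²)/(γπ) + 2)(√2 L (2ρ)/π + 2)`, `γ = 2ρ_min − 4A`, `ρ = (Λ_n + s_max Dt_min (3w_n/4))/(Dt_min − 2A)`.
[cite: BenfattoGiulianiMastropietro2006, §2.5 (2.46)–(2.50)] -/
theorem card_support_klIso_le [DecidablePred fun q : TorusSite 1 (2 * M) × TorusSite 2 L => Gs q ≠ 0] :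
    (((univ : Finset (TorusSite 1 (2 * M) × TorusSite 2 L)).filter fun q => Gs q ≠ 0).card : ℝ) ≤
      (klScale e₀ m * β / π + 1) *
        ((Real.sqrt 2 * L * ((klScale e₀ m + (4 + 4 * A) *
            ((klScale e₀ m + B.smax * B.Dtmin * (3 * sectorWidth (2 * m) / 4)) / (B.Dtmin - 2 * A)) ^ 2) / (2 * B.rhomin - 4 * A)) / π + 2) *
          (Real.sqrt 2 * L * (2 * ((klScale e₀ m + B.smax * B.Dtmin * (3 * sectorWidth (2 * m) / 4)) / (B.Dtmin - 2 * A))) / π + 2)) := by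
  classical
  obtain ⟨-, -, -, -, hGv⟩ := scaleProfile_bounds he m hd1 hd2
  have hΛ : 0 < klScale e₀ m := by rw [klScale]; positivity
  have hL : (0 : ℝ) < L := Nat.cast_pos.2 (Nat.pos_of_ne_zero (NeZero.ne L))
  have hπ := Real.pi_pos
  have hxL : |2 * π / (L : ℝ)| * L = 2 * π := by rw [abs_of_pos (by positivity)]; field_simp
  set ρ : ℝ := (klScale e₀ m + B.smax * B.Dtmin * (3 * sectorWidth (2 * m) / 4)) / (B.Dtmin - 2 * A) with hρdef
  have hρ0 : 0 ≤ ρ := by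
    have := B.smax_pos; have := B.Dtmin_pos; have := sectorWidth_pos (2 * m)
    have : 0 < B.Dtmin - 2 * A := by linarith
    positivity
  set pF : Fin 2 → ℝ := klFermiPoint μ K (sectorCenter (2 * m) (σ : ℕ)) with hpF
  set eK : (Fin 2 → ℝ) → ℝ := fun p => frameLevel μ K (WithLp.toLp 2 p) with heK
  have hcount := card_support_sampledSymbol_le (P := 2 * M) (L := L) hΛ hGv eK Z (pF := pF) (ρ := ρ) hz.le
    (fun p hsq hshell hZp => isoSymbol₁_cell B hA hADt he hz hz1 hgap hlo hhi σ hZ p hsq hshell hZp)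
    Φ (fun k₀ p => hΦ k₀ p) (π * (1 - 2 * M) / β) (2 * π / β) (2 * π / L) hxL Gs
    (fun q => (hGs q).trans (klIso_eq_symbol hA he hz h3 σ hZ hΦ q))
  have hT : (((univ : Finset (TorusSite 1 (2 * M))).filter fun i =>
      |π * (1 - 2 * M) / β + 2 * π / β * (((i 0).val : ℕ) : ℝ)| ≤ klScale e₀ m).card : ℝ) ≤ klScale e₀ m * β / π + 1 := by
    have h := card_filter_timeWindow_le (P := 2 * M) (a₀ := π * (1 - 2 * M) / β) (h₀ := 2 * π / β) (Λ := klScale e₀ m)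
      (by positivity) hΛ.le
    refine h.trans (le_of_eq ?_)
    field_simp
  have hlo' : a ≤ μ - A := by linarith
  have hhi' : μ + A ≤ b := by linarith
  have hγ : 0 < 2 * B.rhomin - 4 * A := by linarith
  have hX : (((univ : Finset (TorusSite 2 L)).filter fun k =>
      |eK (fun j => 2 * π / L * (((k j).valMinAbs : ℤ) : ℝ))| ≤ klScale e₀ m ∧
        ‖(fun j => 2 * π / L * (((k j).valMinAbs : ℤ) : ℝ)) - pF‖ ≤ ρ).card : ℝ) ≤
      (Real.sqrt 2 * L * ((klScale e₀ m + (4 + 4 * A) * ρ ^ 2) / (2 * B.rhomin - 4 * A)) / π + 2) *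
        (Real.sqrt 2 * L * (2 * ρ) / π + 2) := by
    refine card_filter_cell_le L (contDiff_frameBand μ K) (norm_iteratedFDeriv_two_frameBand_le hA μ)
      (pF := pF) (frameLevel_klFermiPoint B hA hlo' hhi' (sectorCenter (2 * m) (σ : ℕ))) hΛ.le hρ0 hγ
      (gradient_floor_klFermiPoint B hA hlo' hhi' (sectorCenter (2 * m) (σ : ℕ))) _ ?_
    intro k hk
    obtain ⟨h1, h2⟩ := (Finset.mem_filter.1 hk).2
    have e : (fun j => 2 * π * (((k j).valMinAbs : ℤ) : ℝ) / L) = fun j => 2 * π / L * (((k j).valMinAbs : ℤ) : ℝ) :=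
      funext fun j => by ring
    rw [e]; exact ⟨h1, h2⟩
  calc _ ≤ ((((univ : Finset (TorusSite 1 (2 * M))).filter fun i =>
        |π * (1 - 2 * M) / β + 2 * π / β * (((i 0).val : ℕ) : ℝ)| ≤ klScale e₀ m).card *
        ((univ : Finset (TorusSite 2 L)).filter fun k =>
          |eK (fun j => 2 * π / L * (((k j).valMinAbs : ℤ) : ℝ))| ≤ klScale e₀ m ∧
            ‖(fun j => 2 * π / L * (((k j).valMinAbs : ℤ) : ℝ)) - pF‖ ≤ ρ).card : ℕ) : ℝ) := by exact_mod_cast hcount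
    _ ≤ _ := by
        push_cast
        exact mul_le_mul hT hX (Nat.cast_nonneg _) (by positivity)

end IsoSingle

end Summit.HubbardSuperconductivity.HubbardSuperconductivity.Theorems.TorusFourierL2

end
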